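import Literature.Probability.RandomPlanarGeometry.SAWBridgeDiamondPoints
import HarnessLib

/-!
# The stickbreak surgery on bridges (Duminil-Copin–Hammond 2013, §4)

Topic `Literature/Probability/RandomPlanarGeometry` (continues `SAWBridgeDiamondPoints.lean`: cones, diamond times
`Zd.IsDiamondTime`, `Zd.diamondTimes`, horizontal deviation `Zd.xDev`).

Source: H. Duminil-Copin, A. Hammond, *Self-avoiding walk is sub-ballistic*, Comm. Math. Phys. 324 (2013)
401–423, arXiv:1205.0401 [DuminilCopinHammond2013], §4, proof of Theorem 2.5 (arXiv v1, p. 23; all pages/equation numbers below as printed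
in arXiv v1): "let
`stickbreak_{i,j}(γ) = γ_{[0,d_i]} ∘ τ^{e_1} ∘ ρ_{π/2,d_i}(γ_{[d_i,d_j]}) ∘ τ^{e_1} ∘ γ_{[d_j,r_n]}`. Here
`ρ_{π/2,d_i}` is … a clockwise rotation of angle `π/2` about `(x(γ_{d_i}), y(γ_{d_i}))` in each hyperplane
`{z ∈ ℝ^d : z_3 = x_3, …, z_d = x_d}`; and `τ^{e_1}` is the length-one walk … the figure shows how this walk
is self-avoiding, a property which is a consequence of the definition of a diamond point." (pp. 23–24, eq. (4.8)):
it is a bridge; (p. 24): its width exceeds `δn/10`; (p. 25): "the solution of this reconstruction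
problem is uniquely determined once we know the indices …"; (4.9)–(4.10) (pp. 24–25), yielding (4.5): the resulting counting inequality.

This file (`y` = coordinate `0`, `x` = coordinate `1` of `ℤ^{d+2}`, as in `SAWBridgeDiamondPoints.lean`):
* `Zd.rotCW` — the rotation `(u₀, u₁, u₂, …) ↦ (−u₁, u₀, u₂, …)` (north `↦` east), `Zd.xStep` the spacer step
  `e₁ = Pi.single 1 1`;
  `Zd.zdGraph_adj_rotCW` (adjacency is preserved), `Zd.rotCW_injective`;
* the three cone separations `Zd.south_ne_xStep_add_rotCW`, `Zd.rotCW_south_ne_xStep_add`,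
  `Zd.south_ne_xStep_add_rotCW_add` (why the three pieces of the stickbreak are disjoint);
* `Zd.stickbreak γ s t` — the surgery at cut times `s ≤ t` (an `N`-step walk becomes an `(N+2)`-step walk);
  `Zd.stickbreak_mem_saws` (self-avoiding at two diamond times), `Zd.stickbreak_mem_bridges` (a bridge when
  `γ` is narrow: `xDev γ ≤ w`, `y(γ_s) ≥ 2w+1`, `y(γ_N) − y(γ_t) ≥ 4w`), `Zd.lt_two_mul_xDev_stickbreak` (wide:
  `2·xDev > q` when `y(γ_t) − y(γ_s) ≥ q + 1`), `Zd.stickbreak_injective` (reconstruction from the cut times);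
* heights at diamond times: `Zd.le_apply_zero_of_card_diamondTimes_lt` & co. (`q` diamond times before /
  between / after force height gaps `≥ q`, since renewal heights are distinct);
* `Zd.sbPairs N q γ`, `Zd.mul_le_card_sbPairs` (`≥ q²` admissible pairs of cut times among `≥ 5q` diamond
  times) and the counting inequality **`Zd.sq_mul_card_le_card_wide_stickbreak`**:
  `q² · #{γ ∈ B_N : #D(γ) ≥ 5q, xDev γ ≤ w} ≤ (N+1)² · #{γ' ∈ B_{N+2} : 2·xDev γ' > q}` for `4w < q`.
  DEVIATION from print: the printed argument fixes the number `n` of renewal points and sums the weights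
  `μ^{-|γ|}` ((4.9)–(4.10), with the renewal-count bookkeeping of p. 24); here the LENGTH `N` is fixed
  and plain cardinalities are compared, which is what the tree's proof of Theorem 2.5
  (`SAWBridgeNoRenewal.lean`) consumes. No renewal points need to be counted.
-/

noncomputable section

open Finset Literature.Probability.LatticeModels Literature.Probability.Percolation
open scoped BigOperators

namespace Literature.Probability.RandomPlanarGeometry.SAW.Zd

variable {d : ℕ}

/-! ### The clockwise rotation in the `(y, x)`-plane and the spacer step `e₁` -/

/-- The unit step `e₁` in the `x`-direction (coordinate `1`): DCH's `τ^{e_1}` (the tree's `Zd.e1` is the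
`y`-direction unit vector `Pi.single 0 1`, hence the name `xStep`).
[cite: DuminilCopinHammond2013, §4, proof of Theorem 2.5 (arXiv v1, p. 23)] -/
def xStep : Site (d + 2) := Pi.single 1 1

/-- `e₁` has `y`-coordinate `0`. [cite: DuminilCopinHammond2013, §4] -/
@[simp] theorem xStep_apply_zero : (xStep : Site (d + 2)) 0 = 0 := by
  simp [xStep]

/-- `e₁` has `x`-coordinate `1`. [cite: DuminilCopinHammond2013, §4] -/
@[simp] theorem xStep_apply_one : (xStep : Site (d + 2)) 1 = 1 := by
  simp [xStep]

/-- The clockwise rotation by `π/2` of the `(x, y)`-plane (north `e₀ ↦` east `e₁`), identity on the other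
coordinates: `(u₀, u₁, u₂, …) ↦ (−u₁, u₀, u₂, …)`; DCH's `ρ_{π/2, d_i}` (about the origin).
[cite: DuminilCopinHammond2013, §4, proof of Theorem 2.5 (arXiv v1, p. 23)] -/
def rotCW (u : Site (d + 2)) : Site (d + 2) :=
  fun i => if i = 0 then -u 1 else if i = 1 then u 0 else u i

/-- `y(rot u) = −x(u)`. [cite: DuminilCopinHammond2013, §4] -/
@[simp] theorem rotCW_apply_zero (u : Site (d + 2)) : rotCW u 0 = -u 1 := by
  simp [rotCW]

/-- `x(rot u) = y(u)`. [cite: DuminilCopinHammond2013, §4] -/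
@[simp] theorem rotCW_apply_one (u : Site (d + 2)) : rotCW u 1 = u 0 := by
  simp [rotCW]

/-- The other coordinates are fixed. [cite: DuminilCopinHammond2013, §4] -/
theorem rotCW_apply_of_two_le (u : Site (d + 2)) {i : Fin (d + 2)} (hi : 2 ≤ i.val) : rotCW u i = u i := by
  have h0 : i ≠ 0 := by rintro rfl; simp at hi
  have h1 : i ≠ 1 := by rintro rfl; simp at hi
  simp [rotCW, h0, h1]

/-- The rotation is additive. [cite: DuminilCopinHammond2013, §4] -/
theorem rotCW_sub (u v : Site (d + 2)) : rotCW (u - v) = rotCW u - rotCW v := by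
  funext i
  by_cases h0 : i = 0
  · subst h0; simp [rotCW]; abel
  · by_cases h1 : i = 1
    · subst h1; simp [rotCW]
    · simp [rotCW, h0, h1]

/-- `rot 0 = 0`. [cite: DuminilCopinHammond2013, §4] -/
@[simp] theorem rotCW_zero : rotCW (0 : Site (d + 2)) = 0 := by
  funext i; simp [rotCW]

/-- `rot (−u) = −rot u`. [cite: DuminilCopinHammond2013, §4] -/
theorem rotCW_neg (u : Site (d + 2)) : rotCW (-u) = -rotCW u := by
  funext i
  by_cases h0 : i = 0
  · subst h0; simp [rotCW]
  · by_cases h1 : i = 1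
    · subst h1; simp [rotCW]
    · simp [rotCW, h0, h1]

/-- The rotation is injective. [cite: DuminilCopinHammond2013, §4] -/
theorem rotCW_injective : Function.Injective (rotCW (d := d)) := by
  intro u v h
  funext i
  by_cases h0 : i = 0
  · subst h0
    have := congrFun h 1
    simpa [rotCW] using this
  · by_cases h1 : i = 1
    · subst h1
      have := congrFun h 0
      simpa [rotCW] using this
    · have := congrFun h i
      simpa [rotCW, h0, h1] using this

/-- The rotation of a unit coordinate vector is `±` a unit coordinate vector. [cite: DuminilCopinHammond2013, §4] -/
theorem rotCW_single (i : Fin (d + 2)) :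
    rotCW (Pi.single i (1 : ℤ) : Site (d + 2)) =
      if i = 0 then Pi.single 1 1 else if i = 1 then -Pi.single 0 1 else Pi.single i 1 := by
  funext j
  by_cases hi0 : i = 0
  · subst hi0
    by_cases hj0 : j = 0
    · subst hj0; simp [rotCW]
    · by_cases hj1 : j = 1
      · subst hj1; simp [rotCW]
      · simp [rotCW, hj0, hj1]
  · by_cases hi1 : i = 1
    · subst hi1
      by_cases hj0 : j = 0
      · subst hj0; simp [rotCW]
      · by_cases hj1 : j = 1
        · subst hj1; simp [rotCW]
        · simp [rotCW, hj0, hj1]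
    · simp only [hi0, hi1, if_false]
      by_cases hj0 : j = 0
      · subst hj0; simp [rotCW, Pi.single_eq_of_ne (Ne.symm hi1), Pi.single_eq_of_ne (Ne.symm hi0)]
      · by_cases hj1 : j = 1
        · subst hj1; simp [rotCW, Pi.single_eq_of_ne (Ne.symm hi1), Pi.single_eq_of_ne (Ne.symm hi0)]
        · simp [rotCW, hj0, hj1]

/-- The rotation preserves adjacency in `ℤ^{d+2}`. [cite: DuminilCopinHammond2013, §4] -/
theorem zdGraph_adj_rotCW {u v : Site (d + 2)} (h : (zdGraph (d + 2)).Adj u v) :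
    (zdGraph (d + 2)).Adj (rotCW u) (rotCW v) := by
  rw [zdGraph_adj_iff_sub] at h ⊢
  obtain ⟨i, hi⟩ := h
  have key : ∃ j : Fin (d + 2), rotCW (Pi.single i (1 : ℤ) : Site (d + 2)) = Pi.single j 1 ∨
      -rotCW (Pi.single i (1 : ℤ) : Site (d + 2)) = Pi.single j 1 := by
    rw [rotCW_single]
    by_cases hi0 : i = 0
    · exact ⟨1, Or.inl (by simp [hi0])⟩
    · by_cases hi1 : i = 1
      · exact ⟨0, Or.inr (by simp [hi1])⟩
      · exact ⟨i, Or.inl (by simp [hi0, hi1])⟩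
  obtain ⟨j, hj⟩ := key
  refine ⟨j, ?_⟩
  rcases hi with hi | hi
  · rw [← rotCW_sub, ← rotCW_sub, ← neg_sub v u, rotCW_neg, hi]
    exact hj
  · rw [← rotCW_sub, ← rotCW_sub, ← neg_sub u v, rotCW_neg, hi]
    exact hj.symm

/-! ### The three cone separations behind the self-avoidance of the stickbreak -/

/-- Initial piece vs rotated middle piece: a south-cone vector is never `e₁ +` the rotation of a
north-cone vector. [cite: DuminilCopinHammond2013, §4, proof of Theorem 2.5 (arXiv v1, p. 23: "self-avoiding … a consequence of the definition of a diamond point")] -/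
theorem south_ne_xStep_add_rotCW {a m : Site (d + 2)} (ha : InSouthCone a) (hm : InNorthCone m) :
    a ≠ xStep + rotCW m := by
  intro h
  have h0 := congrFun h 0
  have h1 := congrFun h 1
  simp only [Pi.add_apply, xStep_apply_zero, rotCW_apply_zero, zero_add, xStep_apply_one, rotCW_apply_one] at h0 h1
  unfold InSouthCone at ha
  unfold InNorthCone at hm
  rw [h0, h1] at ha
  have := le_abs_self (1 + m 0)
  have := le_abs_self (m 1)
  have := abs_nonneg (m 1)
  linarith

/-- Rotated middle piece vs final piece: the rotation of a south-cone vector is never `e₁ +` a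
north-cone vector. [cite: DuminilCopinHammond2013, §4, proof of Theorem 2.5 (arXiv v1, p. 23)] -/
theorem rotCW_south_ne_xStep_add {m c : Site (d + 2)} (hm : InSouthCone m) (hc : InNorthCone c) :
    rotCW m ≠ xStep + c := by
  intro h
  have h0 := congrFun h 0
  have h1 := congrFun h 1
  simp only [Pi.add_apply, xStep_apply_zero, rotCW_apply_zero, zero_add, xStep_apply_one, rotCW_apply_one] at h0 h1
  unfold InSouthCone at hm
  unfold InNorthCone at hc
  have habs : |m 1| = |c 0| := by rw [← abs_neg, h0]
  rw [h1, habs] at hm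
  have := le_abs_self (c 0)
  have := neg_abs_le (c 1)
  linarith

/-- Initial piece vs final piece: a south-cone vector is never `e₁ + rot v + e₁ + c` with `v, c` in the
north cone. [cite: DuminilCopinHammond2013, §4, proof of Theorem 2.5 (arXiv v1, p. 23)] -/
theorem south_ne_xStep_add_rotCW_add {a v c : Site (d + 2)} (ha : InSouthCone a) (hv : InNorthCone v)
    (hc : InNorthCone c) : a ≠ xStep + rotCW v + xStep + c := by
  intro h
  have h0 := congrFun h 0
  have h1 := congrFun h 1
  simp only [Pi.add_apply, xStep_apply_zero, rotCW_apply_zero, zero_add, add_zero, xStep_apply_one,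
    rotCW_apply_one] at h0 h1
  unfold InSouthCone at ha
  unfold InNorthCone at hv hc
  rw [h0, h1] at ha
  have := le_abs_self (1 + v 0 + 1 + c 1)
  have := le_abs_self (v 1)
  have := neg_abs_le (c 1)
  linarith

/-! ### The stickbreak surgery -/

/-- **The stickbreak** of a walk `γ` at times `s ≤ t` (DCH's `stickbreak_{i,j}(γ) = γ_{[0,d_i]} ∘ τ^{e_1} ∘
ρ_{π/2,d_i}(γ_{[d_i,d_j]}) ∘ τ^{e_1} ∘ γ_{[d_j, n]}`): follow `γ` up to time `s`, take one step `e₁`, follow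
the clockwise-rotated piece `γ[s,t]`, take one step `e₁`, then follow the translated piece `γ[t, ·]`. An
`N`-step walk becomes an `(N+2)`-step walk. [cite: DuminilCopinHammond2013, §4, proof of Theorem 2.5 (arXiv v1, p. 23)] -/
def stickbreak (γ : ℕ → Site (d + 2)) (s t : ℕ) : ℕ → Site (d + 2) := fun k =>
  if k ≤ s then γ k
  else if k ≤ t + 1 then γ s + xStep + rotCW (γ (k - 1) - γ s)
  else γ s + xStep + rotCW (γ t - γ s) + xStep + (γ (k - 2) - γ t)

/-- The stickbreak on the initial piece `[0, s]`. [cite: DuminilCopinHammond2013, §4, proof of Theorem 2.5 (arXiv v1, p. 23)] -/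
theorem stickbreak_apply_of_le (γ : ℕ → Site (d + 2)) {s t k : ℕ} (hk : k ≤ s) :
    stickbreak γ s t k = γ k := if_pos hk

/-- The stickbreak on the rotated middle piece: times `s + 1 + i`, `i ≤ t − s`.
[cite: DuminilCopinHammond2013, §4, proof of Theorem 2.5 (arXiv v1, p. 23)] -/
theorem stickbreak_apply_mid (γ : ℕ → Site (d + 2)) {s t : ℕ} (hst : s ≤ t) {i : ℕ} (hi : i ≤ t - s) :
    stickbreak γ s t (s + 1 + i) = γ s + xStep + rotCW (γ (s + i) - γ s) := by
  unfold stickbreak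
  rw [if_neg (by omega), if_pos (by omega), show s + 1 + i - 1 = s + i by omega]

/-- The stickbreak on the final piece: times `t + 2 + j`. [cite: DuminilCopinHammond2013, §4, proof of Theorem 2.5 (arXiv v1, p. 23)] -/
theorem stickbreak_apply_tail (γ : ℕ → Site (d + 2)) {s t : ℕ} (hst : s ≤ t) (j : ℕ) :
    stickbreak γ s t (t + 2 + j) = γ s + xStep + rotCW (γ t - γ s) + xStep + (γ (t + j) - γ t) := by
  unfold stickbreak
  rw [if_neg (by omega), if_neg (by omega), show t + 2 + j - 2 = t + j by omega]

/-- The stickbreak starts where `γ` starts. [cite: DuminilCopinHammond2013, §4] -/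
theorem stickbreak_zero (γ : ℕ → Site (d + 2)) (s t : ℕ) : stickbreak γ s t 0 = γ 0 :=
  stickbreak_apply_of_le γ (Nat.zero_le s)

/-! ### Heights along a bridge: renewal times, diamond counts -/

/-- Heights strictly increase from a renewal time on: `y(γ_r) < y(γ_{r'})` for a renewal time `r < r' ≤ N`.
[cite: DuminilCopinHammond2013, §2.2] -/
theorem IsRenewalTime.apply_zero_lt {N r r' : ℕ} {γ : ℕ → Site (d + 2)} (hr : IsRenewalTime N γ r)
    (hrr' : r < r') (hr'N : r' ≤ N) : γ r 0 < γ r' 0 := by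
  have h := (hr.2.2 (r' - r) (by omega) (by omega)).1
  simp only [add_zero] at h
  rwa [show r + (r' - r) = r' by omega] at h

/-- Heights do not decrease from a renewal time on and stay below the final height:
`y(γ_r) ≤ y(γ_j) ≤ y(γ_N)` for `r ≤ j ≤ N`. [cite: DuminilCopinHammond2013, §2.2] -/
theorem IsRenewalTime.apply_zero_le_and_le {N r j : ℕ} {γ : ℕ → Site (d + 2)} (hr : IsRenewalTime N γ r)
    (hrj : r ≤ j) (hjN : j ≤ N) : γ r 0 ≤ γ j 0 ∧ γ j 0 ≤ γ N 0 := by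
  rcases Nat.eq_or_lt_of_le hrj with rfl | hlt
  · refine ⟨le_rfl, ?_⟩
    rcases Nat.eq_or_lt_of_le hjN with rfl | hlt'
    · exact le_rfl
    · exact (hr.apply_zero_lt hlt' le_rfl).le
  · have h := hr.2.2 (j - r) (by omega) (by omega)
    simp only [add_zero] at h
    rw [show r + (j - r) = j by omega, show r + (N - r) = N by omega] at h
    exact ⟨h.1.le, h.2⟩

/-- Heights up to a renewal time stay below its height: `y(γ_j) ≤ y(γ_r)` for `j ≤ r`.
[cite: DuminilCopinHammond2013, §2.2] -/
theorem IsRenewalTime.apply_zero_le_of_le {N r j : ℕ} {γ : ℕ → Site (d + 2)} (hr : IsRenewalTime N γ r)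
    (hjr : j ≤ r) : γ j 0 ≤ γ r 0 := by
  rcases Nat.eq_zero_or_pos j with rfl | hj
  · rcases Nat.eq_zero_or_pos r with rfl | hrpos
    · exact le_rfl
    · have := (hr.2.1 r hrpos le_rfl).1
      exact this.le
  · exact (hr.2.1 j hj hjr).2

/-- Heights of a bridge from `0` are nonnegative. [cite: MadrasSlade1993, Definition 1.2.4] -/
theorem apply_zero_nonneg_of_mem_bridges {N j : ℕ} {γ : ℕ → Site (d + 2)} (hγ : γ ∈ bridges (d + 2) N) :
    0 ≤ γ j 0 := by
  obtain ⟨hs, hb⟩ := mem_bridges.1 hγ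
  have h0 : γ 0 = 0 := (mem_saws.1 hs).1
  rcases Nat.eq_zero_or_pos j with rfl | hj
  · rw [h0]; rfl
  · rcases le_or_gt j N with hjN | hjN
    · have := (hb j hj hjN).1
      rw [h0] at this
      exact this.le
    · rw [(mem_saws.1 hs).2.1 j hjN.le]
      rcases Nat.eq_zero_or_pos N with rfl | hN
      · rw [h0]; rfl
      · have := (hb N hN le_rfl).1
        rw [h0] at this
        exact this.le

/-- Distinct renewal times have distinct heights (strict monotonicity), as an `InjOn` statement on the
diamond times. [cite: DuminilCopinHammond2013, §2.2] -/
theorem injOn_apply_zero_diamondTimes (N : ℕ) (γ : ℕ → Site (d + 2)) :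
    Set.InjOn (fun r => γ r 0) (diamondTimes N γ : Set ℕ) := by
  intro r hr r' hr' h
  rw [mem_coe, mem_diamondTimes] at hr hr'
  by_contra hne
  rcases Nat.lt_or_gt_of_ne hne with hlt | hlt
  · exact (hr.1.apply_zero_lt hlt hr'.le).ne h
  · exact (hr'.1.apply_zero_lt hlt hr.le).ne h.symm

/-- **`q` diamond times before `s` force `y(γ_s) ≥ q`** (their heights are distinct integers in `[0, y(γ_s))`).
[cite: DuminilCopinHammond2013, §4, proof of Theorem 2.5 (arXiv v1, p. 24: "the height of the rotated piece is larger than its number of diamond points")] -/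
theorem le_apply_zero_of_card_diamondTimes_lt {N s q : ℕ} {γ : ℕ → Site (d + 2)} (hγ : γ ∈ bridges (d + 2) N)
    (hsN : s ≤ N) (hq : q ≤ #((diamondTimes N γ).filter fun r => r < s)) : (q : ℤ) ≤ γ s 0 := by
  classical
  have hmaps : ∀ r ∈ (diamondTimes N γ).filter (fun r => r < s), (fun r => γ r 0) r ∈ Finset.Ico (0 : ℤ) (γ s 0) := by
    intro r hr
    rw [mem_filter, mem_diamondTimes] at hr
    rw [Finset.mem_Ico]
    exact ⟨apply_zero_nonneg_of_mem_bridges hγ, hr.1.1.apply_zero_lt hr.2 hsN⟩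
  have hinj : Set.InjOn (fun r => γ r 0) ((diamondTimes N γ).filter (fun r => r < s) : Set ℕ) :=
    (injOn_apply_zero_diamondTimes N γ).mono (by simp only [coe_filter]; exact fun r hr => hr.1)
  have := (card_le_card_of_injOn _ hmaps hinj)
  rw [Int.card_Ico, sub_zero] at this
  have h0 := apply_zero_nonneg_of_mem_bridges (j := s) hγ
  omega

/-- **`q` diamond times strictly between the diamond times `s < t` force `y(γ_t) − y(γ_s) ≥ q + 1`.**
[cite: DuminilCopinHammond2013, §4, proof of Theorem 2.5 (arXiv v1, pp. 23–24)] -/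
theorem add_le_apply_zero_of_card_diamondTimes_btw {N s t q : ℕ} {γ : ℕ → Site (d + 2)}
    (hs : IsDiamondTime N γ s) (hst : s < t) (htN : t ≤ N)
    (hq : q ≤ #((diamondTimes N γ).filter fun r => s < r ∧ r < t)) : γ s 0 + q + 1 ≤ γ t 0 := by
  classical
  have hlt : γ s 0 < γ t 0 := hs.1.apply_zero_lt hst htN
  have hmaps : ∀ r ∈ (diamondTimes N γ).filter (fun r => s < r ∧ r < t),
      (fun r => γ r 0) r ∈ Finset.Ioo (γ s 0) (γ t 0) := by
    intro r hr
    rw [mem_filter, mem_diamondTimes] at hr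
    rw [Finset.mem_Ioo]
    exact ⟨hs.1.apply_zero_lt hr.2.1 hr.1.le, hr.1.1.apply_zero_lt hr.2.2 htN⟩
  have hinj : Set.InjOn (fun r => γ r 0) ((diamondTimes N γ).filter (fun r => s < r ∧ r < t) : Set ℕ) :=
    (injOn_apply_zero_diamondTimes N γ).mono (by simp only [coe_filter]; exact fun r hr => hr.1)
  have := card_le_card_of_injOn _ hmaps hinj
  rw [Int.card_Ioo] at this
  omega

/-- **`q` diamond times after the diamond time `t` force `y(γ_N) − y(γ_t) ≥ q`.**
[cite: DuminilCopinHammond2013, §4, proof of Theorem 2.5 (arXiv v1, p. 24: "at least δn/10 diamond points of γ whose index lies between d_j and r_n")] -/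
theorem add_le_apply_zero_last_of_card_diamondTimes_gt {N t q : ℕ} {γ : ℕ → Site (d + 2)}
    (ht : IsDiamondTime N γ t) (hq : q ≤ #((diamondTimes N γ).filter fun r => t < r)) :
    γ t 0 + q ≤ γ N 0 := by
  classical
  have hle : γ t 0 ≤ γ N 0 := (ht.1.apply_zero_le_and_le le_rfl ht.le).2
  have hmaps : ∀ r ∈ (diamondTimes N γ).filter (fun r => t < r),
      (fun r => γ r 0) r ∈ Finset.Ioc (γ t 0) (γ N 0) := by
    intro r hr
    rw [mem_filter, mem_diamondTimes] at hr
    rw [Finset.mem_Ioc]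
    exact ⟨ht.1.apply_zero_lt hr.2 hr.1.le, (hr.1.1.apply_zero_le_and_le le_rfl hr.1.le).2⟩
  have hinj : Set.InjOn (fun r => γ r 0) ((diamondTimes N γ).filter (fun r => t < r) : Set ℕ) :=
    (injOn_apply_zero_diamondTimes N γ).mono (by simp only [coe_filter]; exact fun r hr => hr.1)
  have := card_le_card_of_injOn _ hmaps hinj
  rw [Int.card_Ioc] at this
  omega

/-- The stickbreak on the rotated middle piece, by time: `s < k ≤ t + 1`.
[cite: DuminilCopinHammond2013, §4, proof of Theorem 2.5 (arXiv v1, p. 23)] -/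
theorem stickbreak_apply_of_mid (γ : ℕ → Site (d + 2)) {s t k : ℕ} (hsk : s < k) (hkt : k ≤ t + 1) :
    stickbreak γ s t k = γ s + xStep + rotCW (γ (k - 1) - γ s) := by
  unfold stickbreak
  rw [if_neg (by omega), if_pos hkt]

/-- The stickbreak on the final piece, by time: `t + 2 ≤ k`. [cite: DuminilCopinHammond2013, §4, proof of Theorem 2.5 (arXiv v1, p. 23)] -/
theorem stickbreak_apply_of_tail (γ : ℕ → Site (d + 2)) {s t k : ℕ} (hst : s ≤ t) (hk : t + 2 ≤ k) :
    stickbreak γ s t k = γ s + xStep + rotCW (γ t - γ s) + xStep + (γ (k - 2) - γ t) := by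
  unfold stickbreak
  rw [if_neg (by omega), if_neg (by omega)]

/-- Translating both endpoints preserves adjacency (left translation). [folklore] -/
private theorem zdGraph_adj_const_add {c x y : Site (d + 2)} (h : (zdGraph (d + 2)).Adj x y) :
    (zdGraph (d + 2)).Adj (c + x) (c + y) := by
  rw [add_comm c x, add_comm c y]
  exact (zdGraph_adj_add_right x y c).2 h

/-- A site is adjacent to its `e₁`-translate. [folklore] -/
private theorem zdGraph_adj_add_xStep (x : Site (d + 2)) : (zdGraph (d + 2)).Adj x (x + xStep) := by
  rw [zdGraph_adj_iff_sub]
  exact ⟨1, Or.inl (by simp [xStep])⟩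

section Stickbreak

variable {N s t : ℕ} {γ : ℕ → Site (d + 2)}

/-- **The stickbreak of a bridge at two diamond times `s < t` is a self-avoiding walk of length `N + 2`**:
the three pieces are separated by the cones (`south_ne_xStep_add_rotCW`, `rotCW_south_ne_xStep_add`,
`south_ne_xStep_add_rotCW_add`). [cite: DuminilCopinHammond2013, §4, proof of Theorem 2.5 (arXiv v1, p. 23; Figure 3, p. 10)] -/
theorem stickbreak_mem_saws (hγ : γ ∈ bridges (d + 2) N) (hs : IsDiamondTime N γ s)
    (ht : IsDiamondTime N γ t) (hst : s < t) : stickbreak γ s t ∈ saws (d + 2) (N + 2) := by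
  obtain ⟨h0, hend, hadj, hinj⟩ := mem_saws.1 (mem_bridges.1 hγ).1
  have htN : t ≤ N := ht.le
  have hsN : s ≤ N := hs.le
  set P := γ s + xStep + rotCW (γ t - γ s) + xStep with hP
  -- values on the three pieces
  have vA : ∀ k ≤ s, stickbreak γ s t k = γ k := fun k hk => stickbreak_apply_of_le γ hk
  have vB : ∀ k, s < k → k ≤ t + 1 → stickbreak γ s t k = γ s + xStep + rotCW (γ (k - 1) - γ s) :=
    fun k h1 h2 => stickbreak_apply_of_mid γ h1 h2
  have vC : ∀ k, t + 2 ≤ k → stickbreak γ s t k = P + (γ (k - 2) - γ t) :=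
    fun k hk => stickbreak_apply_of_tail γ hst.le hk
  -- the cross separations
  have neAB : ∀ a b, a ≤ s → s < b → b ≤ t + 1 → stickbreak γ s t a ≠ stickbreak γ s t b := by
    intro a b ha hb1 hb2 h
    rw [vA a ha, vB b hb1 hb2] at h
    have h' : γ a - γ s = xStep + rotCW (γ (b - 1) - γ s) := by rw [h]; abel
    exact south_ne_xStep_add_rotCW (hs.2.1 a ha) (hs.2.2 (b - 1) (by omega) (by omega)) h'
  have neAC : ∀ a b, a ≤ s → t + 2 ≤ b → b ≤ N + 2 → stickbreak γ s t a ≠ stickbreak γ s t b := by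
    intro a b ha hb1 hb2 h
    rw [vA a ha, vC b hb1, hP] at h
    have h' : γ a - γ s = xStep + rotCW (γ t - γ s) + xStep + (γ (b - 2) - γ t) := by rw [h]; abel
    exact south_ne_xStep_add_rotCW_add (hs.2.1 a ha) (hs.2.2 t hst.le htN)
      (ht.2.2 (b - 2) (by omega) (by omega)) h'
  have neBC : ∀ a b, s < a → a ≤ t + 1 → t + 2 ≤ b → b ≤ N + 2 →
      stickbreak γ s t a ≠ stickbreak γ s t b := by
    intro a b ha1 ha2 hb1 hb2 h
    rw [vB a ha1 ha2, vC b hb1, hP] at h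
    have h' : rotCW (γ (a - 1) - γ s) - rotCW (γ t - γ s) = xStep + (γ (b - 2) - γ t) := by
      have := sub_eq_zero.2 h
      rw [← sub_eq_zero, ← this]
      abel
    rw [← rotCW_sub, sub_sub_sub_cancel_right] at h'
    exact rotCW_south_ne_xStep_add (ht.2.1 (a - 1) (by omega)) (ht.2.2 (b - 2) (by omega) (by omega)) h'
  refine mem_saws.2 ⟨by rw [stickbreak_zero, h0], fun k hk => ?_, fun k hk => ?_, fun a ha b hb hab => ?_⟩
  · -- frozen after `N + 2`
    rw [vC k (by omega), vC (N + 2) (by omega), hend (k - 2) (by omega), show N + 2 - 2 = N by omega]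
  · -- adjacency
    rcases Nat.lt_or_ge (k + 1) (s + 1) with h1 | h1
    · rw [vA k (by omega), vA (k + 1) (by omega)]
      exact hadj k (by omega)
    rcases Nat.eq_or_lt_of_le h1 with h2 | h2
    · have hk : k = s := by omega
      subst hk
      rw [vA k le_rfl, vB (k + 1) (by omega) (by omega), show k + 1 - 1 = k by omega, sub_self, rotCW_zero,
        add_zero]
      exact zdGraph_adj_add_xStep _
    rcases Nat.lt_or_ge (k + 1) (t + 2) with h3 | h3
    · rw [vB k (by omega) (by omega), vB (k + 1) (by omega) (by omega), show k + 1 - 1 = k by omega]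
      refine zdGraph_adj_const_add (zdGraph_adj_rotCW ?_)
      rw [zdGraph_adj_sub_right]
      have := hadj (k - 1) (by omega)
      rwa [show k - 1 + 1 = k by omega] at this
    rcases Nat.eq_or_lt_of_le h3 with h4 | h4
    · have hk : k = t + 1 := by omega
      subst hk
      rw [vB (t + 1) (by omega) le_rfl, vC (t + 1 + 1) (by omega), show t + 1 - 1 = t by omega,
        show t + 1 + 1 - 2 = t by omega, sub_self, add_zero, hP]
      exact zdGraph_adj_add_xStep _
    · rw [vC k (by omega), vC (k + 1) (by omega), show k + 1 - 2 = k - 2 + 1 by omega]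
      exact zdGraph_adj_const_add ((zdGraph_adj_sub_right _ _ _).2 (hadj (k - 2) (by omega)))
  · -- injectivity
    replace ha : a ≤ N + 2 := ha
    replace hb : b ≤ N + 2 := hb
    -- classify `a` and `b`
    rcases le_or_gt a s with haA | haA <;> rcases le_or_gt b s with hbA | hbA
    · rw [vA a haA, vA b hbA] at hab
      exact hinj (show a ≤ N by omega) (show b ≤ N by omega) hab
    · rcases le_or_gt b (t + 1) with hbB | hbB
      · exact absurd hab (neAB a b haA hbA hbB)
      · exact absurd hab (neAC a b haA (by omega) hb)
    · rcases le_or_gt a (t + 1) with haB | haB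
      · exact absurd hab.symm (neAB b a hbA haA haB)
      · exact absurd hab.symm (neAC b a hbA (by omega) ha)
    · rcases le_or_gt a (t + 1) with haB | haB <;> rcases le_or_gt b (t + 1) with hbB | hbB
      · rw [vB a haA haB, vB b hbA hbB, add_right_inj] at hab
        have := rotCW_injective hab
        rw [sub_left_inj] at this
        have := hinj (show a - 1 ≤ N by omega) (show b - 1 ≤ N by omega) this
        omega
      · exact absurd hab (neBC a b haA haB (by omega) hb)
      · exact absurd hab.symm (neBC b a hbA hbB (by omega) ha)
      · rw [vC a (by omega), vC b (by omega), add_right_inj, sub_left_inj] at hab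
        have := hinj (show a - 2 ≤ N by omega) (show b - 2 ≤ N by omega) hab
        omega

/-- **The stickbreak of a narrow bridge is a bridge**: if `|x| ≤ w` along `γ`, `y(γ_s) ≥ 2w + 1` and
`y(γ_N) − y(γ_t) ≥ 4w`, the heights of `stickbreak γ s t` stay in `(0, final height]`.
[cite: DuminilCopinHammond2013, §4, proof of Theorem 2.5, eq. (4.8) (arXiv v1, pp. 23–24)] -/
theorem stickbreak_mem_bridges (hγ : γ ∈ bridges (d + 2) N) (hs : IsDiamondTime N γ s)
    (ht : IsDiamondTime N γ t) (hst : s < t) {w : ℕ} (hw : xDev N γ ≤ w) (hys : 2 * (w : ℤ) + 1 ≤ γ s 0)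
    (hyt : γ t 0 + 4 * (w : ℤ) ≤ γ N 0) : stickbreak γ s t ∈ bridges (d + 2) (N + 2) := by
  refine mem_bridges.2 ⟨stickbreak_mem_saws hγ hs ht hst, fun k hk1 hk2 => ?_⟩
  obtain ⟨hsaw, hbr⟩ := mem_bridges.1 hγ
  have h0 : γ 0 = 0 := (mem_saws.1 hsaw).1
  have htN : t ≤ N := ht.le
  have hsN : s ≤ N := hs.le
  have hx := xDev_le_iff.1 hw
  have hxs := abs_le.1 (hx s hsN)
  have hxt := abs_le.1 (hx t htN)
  -- the final height
  have hF : stickbreak γ s t (N + 2) 0 = γ s 0 - (γ t 1 - γ s 1) + (γ N 0 - γ t 0) := by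
    rw [stickbreak_apply_of_tail γ hst.le (show t + 2 ≤ N + 2 by omega), show N + 2 - 2 = N by omega]
    simp only [Pi.add_apply, Pi.sub_apply, xStep_apply_zero, rotCW_apply_zero]
    ring
  rw [stickbreak_zero, h0, hF, show (0 : Site (d + 2)) 0 = 0 from rfl]
  rcases le_or_gt k s with hkA | hkA
  · -- initial piece
    rw [stickbreak_apply_of_le γ hkA]
    have h1 := (hbr k hk1 (by omega)).1
    rw [h0] at h1
    have h2 := hs.1.apply_zero_le_of_le hkA
    exact ⟨h1, by linarith⟩
  rcases le_or_gt k (t + 1) with hkB | hkB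
  · -- rotated middle piece
    rw [stickbreak_apply_of_mid γ hkA hkB]
    simp only [Pi.add_apply, Pi.sub_apply, xStep_apply_zero, rotCW_apply_zero]
    have hxk := abs_le.1 (hx (k - 1) (by omega))
    constructor <;> linarith
  · -- final piece
    rw [stickbreak_apply_of_tail γ hst.le (by omega)]
    simp only [Pi.add_apply, Pi.sub_apply, xStep_apply_zero, rotCW_apply_zero]
    have h3 := ht.1.apply_zero_le_and_le (show t ≤ k - 2 by omega) (show k - 2 ≤ N by omega)
    constructor <;> linarith

/-- **The stickbreak is wide**: its horizontal deviation exceeds half the height `y(γ_t) − y(γ_s)` of the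
rotated piece. [cite: DuminilCopinHammond2013, §4, proof of Theorem 2.5 (arXiv v1, p. 24: "the width of StickBreak_(i,j)(γ) is larger than δn/10")] -/
theorem lt_two_mul_xDev_stickbreak (htN : t ≤ N) (hst : s ≤ t) {q : ℕ} (hq : γ s 0 + q + 1 ≤ γ t 0) :
    q < 2 * xDev (N + 2) (stickbreak γ s t) := by
  have h1 := abs_le_xDev (N := N + 2) (stickbreak γ s t) (j := s + 1) (by omega)
  have h2 := abs_le_xDev (N := N + 2) (stickbreak γ s t) (j := t + 1) (by omega)
  rw [stickbreak_apply_of_mid γ (Nat.lt_succ_self s) (by omega), show s + 1 - 1 = s by omega] at h1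
  rw [stickbreak_apply_of_mid γ (by omega) le_rfl, show t + 1 - 1 = t by omega] at h2
  simp only [Pi.add_apply, Pi.sub_apply, xStep_apply_one, rotCW_apply_one, sub_self, rotCW_zero,
    Pi.zero_apply, add_zero] at h1 h2
  have h3 : |γ s 1 + 1 + (γ t 0 - γ s 0) - (γ s 1 + 1)| ≤ |γ s 1 + 1 + (γ t 0 - γ s 0)| + |γ s 1 + 1| := by
    simpa only [sub_eq_add_neg, abs_neg] using abs_add_le (γ s 1 + 1 + (γ t 0 - γ s 0)) (-(γ s 1 + 1))
  have h4 : |γ s 1 + 1 + (γ t 0 - γ s 0) - (γ s 1 + 1)| = γ t 0 - γ s 0 := by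
    rw [show γ s 1 + 1 + (γ t 0 - γ s 0) - (γ s 1 + 1) = γ t 0 - γ s 0 by ring]
    exact abs_of_nonneg (by omega)
  have : (q : ℤ) < 2 * (xDev (N + 2) (stickbreak γ s t) : ℤ) := by linarith
  exact_mod_cast this

/-- **Reconstruction**: for fixed cut times `s ≤ t ≤ N`, the stickbreak is injective on `N`-step walks
("it is enough to find each of the renewal point indices `r` and `r'`").
[cite: DuminilCopinHammond2013, §4, proof of Theorem 2.5 (arXiv v1, p. 25; sketch in §2.3, p. 9)] -/
theorem stickbreak_injective {γ γ' : ℕ → Site (d + 2)} (hst : s ≤ t)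
    (h : stickbreak γ s t = stickbreak γ' s t) : γ = γ' := by
  have hA : ∀ k ≤ s, γ k = γ' k := by
    intro k hk
    rw [← stickbreak_apply_of_le γ (t := t) hk, ← stickbreak_apply_of_le γ' (t := t) hk, h]
  have hss : γ s = γ' s := hA s le_rfl
  have hB : ∀ k, s ≤ k → k ≤ t → γ k = γ' k := by
    intro k h1 h2
    have e := congrFun h (k + 1)
    rw [stickbreak_apply_of_mid γ (by omega) (by omega), stickbreak_apply_of_mid γ' (by omega) (by omega),
      show k + 1 - 1 = k by omega, hss, add_right_inj] at e
    have := rotCW_injective e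
    rwa [sub_left_inj] at this
  have htt : γ t = γ' t := hB t hst le_rfl
  have hC : ∀ k, t ≤ k → γ k = γ' k := by
    intro k hk
    have e := congrFun h (k + 2)
    rw [stickbreak_apply_of_tail γ hst (by omega), stickbreak_apply_of_tail γ' hst (by omega),
      show k + 2 - 2 = k by omega, hss, htt, add_right_inj, sub_left_inj] at e
    exact e
  funext k
  rcases le_or_gt k s with h1 | h1
  · exact hA k h1
  rcases le_or_gt k t with h2 | h2
  · exact hB k h1.le h2
  · exact hC k h2.le

end Stickbreak

/-! ### Admissible pairs of cut times and the counting inequality -/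

open Classical in
/-- The admissible pairs `(s, t)` of cut times of an `N`-step walk for the parameter `q`: both are diamond
times, with at least `q` diamond times before `s`, at least `q` strictly between, and at least `q` after `t`
(DCH: `i ∈ [δn/10, 2δn/10]`, `j ∈ [3δn/10, 4δn/10]` among `≥ δn/2` diamond points).
[cite: DuminilCopinHammond2013, §4, proof of Theorem 2.5 (arXiv v1, p. 23)] -/
def sbPairs (N q : ℕ) (γ : ℕ → Site (d + 2)) : Finset (ℕ × ℕ) :=
  ((diamondTimes N γ) ×ˢ (diamondTimes N γ)).filter fun p =>
    q ≤ #((diamondTimes N γ).filter fun r => r < p.1) ∧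
    q ≤ #((diamondTimes N γ).filter fun r => p.1 < r ∧ r < p.2) ∧
    q ≤ #((diamondTimes N γ).filter fun r => p.2 < r)

open Classical in
/-- Membership in `sbPairs`. [cite: DuminilCopinHammond2013, §4, proof of Theorem 2.5 (arXiv v1, p. 23)] -/
theorem mem_sbPairs {N q : ℕ} {γ : ℕ → Site (d + 2)} {p : ℕ × ℕ} :
    p ∈ sbPairs N q γ ↔ (p.1 ∈ diamondTimes N γ ∧ p.2 ∈ diamondTimes N γ) ∧
      q ≤ #((diamondTimes N γ).filter fun r => r < p.1) ∧
      q ≤ #((diamondTimes N γ).filter fun r => p.1 < r ∧ r < p.2) ∧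
      q ≤ #((diamondTimes N γ).filter fun r => p.2 < r) := by
  rw [sbPairs, mem_filter, mem_product]

open Classical in
/-- **There are at least `q²` admissible pairs when there are at least `5q` diamond times** (the pairs of
the `a`-th and `b`-th diamond times, `a ∈ [q, 2q)`, `b ∈ [3q, 4q)`).
[cite: DuminilCopinHammond2013, §4, proof of Theorem 2.5 (arXiv v1, p. 23, and eq. (4.9), p. 24: `(δn/10)²` pairs)] -/
theorem mul_le_card_sbPairs {N q : ℕ} {γ : ℕ → Site (d + 2)} (h5 : 5 * q ≤ #(diamondTimes N γ)) :
    q * q ≤ #(sbPairs N q γ) := by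
  set D := diamondTimes N γ with hD
  set n := #D with hn
  let e : Fin n ↪o ℕ := D.orderEmbOfFin hn.symm
  have he_mem : ∀ i, e i ∈ D := fun i => D.orderEmbOfFin_mem hn.symm i
  -- counting diamond times before / between / after values of `e`
  have cnt_lt : ∀ a : Fin n, (a : ℕ) ≤ #(D.filter fun r => r < e a) := by
    intro a
    calc (a : ℕ) = #(Finset.Iio a) := (Fin.card_Iio a).symm
      _ ≤ #(D.filter fun r => r < e a) := by
        refine card_le_card_of_injOn (fun i => e i) (fun i hi => ?_) (fun i _ j _ hij => e.injective hij)
        rw [mem_coe, Finset.mem_Iio] at hi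
        rw [mem_coe, mem_filter]
        exact ⟨he_mem i, e.lt_iff_lt.2 hi⟩
  have cnt_btw : ∀ a b : Fin n, (b : ℕ) - a - 1 ≤ #(D.filter fun r => e a < r ∧ r < e b) := by
    intro a b
    calc (b : ℕ) - a - 1 = #(Finset.Ioo a b) := (Fin.card_Ioo a b).symm
      _ ≤ #(D.filter fun r => e a < r ∧ r < e b) := by
        refine card_le_card_of_injOn (fun i => e i) (fun i hi => ?_) (fun i _ j _ hij => e.injective hij)
        rw [mem_coe, Finset.mem_Ioo] at hi
        rw [mem_coe, mem_filter]
        exact ⟨he_mem i, e.lt_iff_lt.2 hi.1, e.lt_iff_lt.2 hi.2⟩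
  have cnt_gt : ∀ b : Fin n, n - 1 - (b : ℕ) ≤ #(D.filter fun r => e b < r) := by
    intro b
    calc n - 1 - (b : ℕ) = #(Finset.Ioi b) := (Fin.card_Ioi b).symm
      _ ≤ #(D.filter fun r => e b < r) := by
        refine card_le_card_of_injOn (fun i => e i) (fun i hi => ?_) (fun i _ j _ hij => e.injective hij)
        rw [mem_coe, Finset.mem_Ioi] at hi
        rw [mem_coe, mem_filter]
        exact ⟨he_mem i, e.lt_iff_lt.2 hi⟩
  -- the injection `(i, j) ↦ (e (q+i), e (3q+j))`
  let f : ℕ × ℕ → ℕ × ℕ := fun ij =>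
    if h : q + ij.1 < n ∧ 3 * q + ij.2 < n then (e ⟨q + ij.1, h.1⟩, e ⟨3 * q + ij.2, h.2⟩) else (0, 0)
  have hf : ∀ ij ∈ range q ×ˢ range q, q + ij.1 < n ∧ 3 * q + ij.2 < n := by
    intro ij hij
    rw [mem_product, mem_range, mem_range] at hij
    omega
  calc q * q = #(range q ×ˢ range q) := by rw [card_product, card_range]
    _ ≤ #(sbPairs N q γ) := by
      refine card_le_card_of_injOn f (fun ij hij => ?_) (fun ij hij ij' hij' h => ?_)
      · rw [mem_coe] at hij
        have hc := hf ij hij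
        rw [mem_product, mem_range, mem_range] at hij
        have hfij : f ij = (e ⟨q + ij.1, hc.1⟩, e ⟨3 * q + ij.2, hc.2⟩) := dif_pos hc
        rw [mem_coe, hfij, mem_sbPairs]
        refine ⟨⟨he_mem _, he_mem _⟩, le_trans (by simp) (cnt_lt _), le_trans ?_ (cnt_btw _ _),
          le_trans ?_ (cnt_gt _)⟩
        · dsimp only; omega
        · dsimp only; omega
      · rw [mem_coe] at hij hij'
        have hc := hf ij hij
        have hc' := hf ij' hij'
        have h1 : f ij = (e ⟨q + ij.1, hc.1⟩, e ⟨3 * q + ij.2, hc.2⟩) := dif_pos hc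
        have h2 : f ij' = (e ⟨q + ij'.1, hc'.1⟩, e ⟨3 * q + ij'.2, hc'.2⟩) := dif_pos hc'
        rw [h1, h2, Prod.mk.injEq] at h
        have ha := congrArg Fin.val (e.injective h.1)
        have hb := congrArg Fin.val (e.injective h.2)
        dsimp only at ha hb
        exact Prod.ext (by omega) (by omega)

open Classical in
/-- **The stickbreak counting inequality** (multi-valued map principle at fixed length): for `4w < q`,
`q² · #{γ ∈ B_N : ≥ 5q diamond times, xDev γ ≤ w} ≤ (N+1)² · #{γ' ∈ B_{N+2} : 2·xDev γ' > q}` — each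
admissible `(γ, s, t)` yields the wide `(N+2)`-step bridge `stickbreak γ s t`, and `(γ, s, t)` is recovered
from `(stickbreak γ s t, s, t)`. [cite: DuminilCopinHammond2013, §4, proof of Theorem 2.5, eqs. (4.9)–(4.10) (arXiv v1, pp. 24–25)] -/
theorem sq_mul_card_le_card_wide_stickbreak (N q w : ℕ) (hqw : 4 * w < q) :
    (q : ℝ) ^ 2 * #((bridges (d + 2) N).filter fun γ => 5 * q ≤ #(diamondTimes N γ) ∧ xDev N γ ≤ w) ≤
      ((N : ℝ) + 1) ^ 2 * #((bridges (d + 2) (N + 2)).filter fun γ' => q < 2 * xDev (N + 2) γ') := by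
  set G := (bridges (d + 2) N).filter fun γ => 5 * q ≤ #(diamondTimes N γ) ∧ xDev N γ ≤ w with hG
  set W := (bridges (d + 2) (N + 2)).filter fun γ' => q < 2 * xDev (N + 2) γ' with hW
  set Φ := G.sigma fun γ => sbPairs N q γ with hΦ
  -- (1) `q² #G ≤ #Φ`
  have h1 : q * q * #G ≤ #Φ := by
    rw [hΦ, card_sigma, mul_comm, ← smul_eq_mul, ← sum_const]
    refine sum_le_sum fun γ hγ => mul_le_card_sbPairs ?_
    rw [hG, mem_filter] at hγ
    exact hγ.2.1
  -- (2) `#Φ ≤ #W (N+1)²`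
  have h2 : #Φ ≤ #W * ((N + 1) * (N + 1)) := by
    rw [← card_range (N + 1), ← card_product, ← card_product]
    refine card_le_card_of_injOn (fun x => (stickbreak x.1 x.2.1 x.2.2, x.2)) (fun x hx => ?_)
      (fun x hx y hy hxy => ?_)
    · rw [mem_coe, hΦ, mem_sigma, hG, mem_filter, mem_sbPairs] at hx
      obtain ⟨⟨hγB, h5, hxw⟩, ⟨hsD, htD⟩, hc1, hc2, hc3⟩ := hx
      rw [mem_diamondTimes] at hsD htD
      have hq1 : 1 ≤ q := by omega
      obtain ⟨r, hr⟩ : ((diamondTimes N x.1).filter fun r => x.2.1 < r ∧ r < x.2.2).Nonempty := by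
        rw [← card_pos]; omega
      rw [mem_filter] at hr
      have hst : x.2.1 < x.2.2 := hr.2.1.trans hr.2.2
      have hys := le_apply_zero_of_card_diamondTimes_lt hγB hsD.le hc1
      have hyst := add_le_apply_zero_of_card_diamondTimes_btw hsD hst htD.le hc2
      have hyt := add_le_apply_zero_last_of_card_diamondTimes_gt htD hc3
      rw [mem_coe, mem_product, hW, mem_filter, mem_product, mem_range, mem_range]
      refine ⟨⟨stickbreak_mem_bridges hγB hsD htD hst hxw (by omega) (by omega),
        lt_two_mul_xDev_stickbreak htD.le hst.le hyst⟩, Nat.lt_succ_of_le hsD.le, Nat.lt_succ_of_le htD.le⟩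
    · rw [mem_coe, hΦ, mem_sigma, mem_sbPairs] at hx hy
      simp only [Prod.mk.injEq] at hxy
      obtain ⟨hsb, hp⟩ := hxy
      have hq1 : 1 ≤ q := by omega
      obtain ⟨r, hr⟩ : ((diamondTimes N x.1).filter fun r => x.2.1 < r ∧ r < x.2.2).Nonempty := by
        rw [← card_pos]; omega
      rw [mem_filter] at hr
      have hst : x.2.1 ≤ x.2.2 := (hr.2.1.trans hr.2.2).le
      rw [← hp] at hsb
      have hγ := stickbreak_injective hst hsb
      obtain ⟨γ, p⟩ := x
      obtain ⟨γ', p'⟩ := y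
      simp only at hγ hp
      subst hγ
      subst hp
      rfl
  -- (3) combine
  have h3 : (q : ℝ) ^ 2 * #G = ((q * q * #G : ℕ) : ℝ) := by push_cast; ring
  have h4 : ((N : ℝ) + 1) ^ 2 * #W = ((#W * ((N + 1) * (N + 1)) : ℕ) : ℝ) := by push_cast; ring
  rw [h3, h4]
  exact_mod_cast h1.trans h2


end Literature.Probability.RandomPlanarGeometry.SAW.Zd

end
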